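import Literature.Barriers.QuantumAdvantage.PBlockedSim
import Literature.Barriers.QuantumAdvantage.BoundedEntanglementConfigs
import HarnessLib

/-!
# The bit-list layer of the `p`-blocked simulator: masks, configurations, enumeration

Topic `Literature/Barriers/QuantumAdvantage`; first file of the *specification* of the functional
program `PSim` (`PBlockedSim.lean`, the classical machine of Jozsa–Linden's lemma `ratpbl` /
theorem `pblthm`) against the canonical block data of the quantum half
(`BoundedEntanglementBlocks.lean`, `BoundedEntanglementGramZUpdate.lean`). The program works on
`N`-bit lists (wire `0` first); the quantum half works on register configurations
`QReg N = Fin N → Bool`, wire sets `Finset (Fin N)` and the configuration sets `cfg X`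
(`BoundedEntanglementConfigs.lean`). This file is the dictionary between the two:

* `toReg N u` — the configuration read off a bit list (`u.getD i false`), `maskSet N m` — the wire
  set of a mask; length-`N` lists are determined by their reading (`ext_of_toReg_eq`);
* the bitwise operations of the program under the dictionary: `toReg_band` (`∧`), `toReg_bor`,
  `toReg_bandnot`, **`toReg_pw`** (`pw S u v ↦ S.piecewise u v`), `toReg_zeros`, `toReg_oneHot`,
  `maskSet_band` (`∩`), `maskSet_bandnot` (`\`), `maskSet_bor` (`∪`), `maskSet_oneHot` (`{i}`),
  `toReg_setAt` (`Function.update`), `toReg_append_zeros` (the padded input `padInput`);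
* `popcount_eq_card_maskSet` — the bit count of a length-`N` mask is the size of its wire set;
* the enumeration `deposit`/`subCfgs`: `length_deposit`, `getD_deposit_imp` (supported in the
  mask), `deposit_injOn`, `exists_deposit_eq` and the packaging **`mem_subCfgs_iff`** /
  `nodup_subCfgs` / `toFinset_map_toReg_subCfgs`: for a length-`N` mask `m` of at most `2p` set
  bits, `subCfgs p m` lists without repetition exactly the length-`N` lists supported in `m`, and
  reading them off gives exactly `cfg (maskSet N m)` — so list sums over `subCfgs` are the finite
  sums over `cfg` of the quantum half (`sum_map_subCfgs_eq_sum_cfg`).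

## References

* R. Jozsa, N. Linden, *On the role of entanglement in quantum-computational speed-up*, Proc. R.
  Soc. Lond. A 459 (2003) 2011–2032, arXiv:quant-ph/0201143: §3, proof of lemma `ratpbl`
  ((a) block locations, (b) block states "listing the amplitudes in the computational basis").
-/

namespace Literature.Barriers.QuantumAdvantage

namespace PSim

open Finset Literature.Computability.Cryptography

variable {N : ℕ}

/-! ### Reading bit lists as configurations and masks as wire sets -/

/-- The register configuration read off a bit list: bit `i` is `u.getD i false` (wires beyond the
end of the list read `false`). [folklore] -/
def toReg (N : ℕ) (u : Cfg) : QReg N := fun i => u.getD i false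

/-- The wire set of a mask: the positions `< N` holding `true`. [cite: JozsaLinden2003, §3 (proof of lemma ratpbl, (a) block locations)] -/
def maskSet (N : ℕ) (m : Cfg) : Finset (Fin N) := univ.filter fun i => m.getD i false = true

/-- Value of `toReg` (definitional). [folklore] -/
@[simp] theorem toReg_apply (u : Cfg) (i : Fin N) : toReg N u i = u.getD i false := rfl

/-- Membership in the wire set of a mask. [folklore] -/
@[simp] theorem mem_maskSet {m : Cfg} {i : Fin N} : i ∈ maskSet N m ↔ m.getD i false = true := by
  simp [maskSet]

/-- Membership in the wire set of a mask, through its reading. [folklore] -/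
theorem mem_maskSet_iff_toReg {m : Cfg} {i : Fin N} : i ∈ maskSet N m ↔ toReg N m i = true :=
  mem_maskSet

/-- Two masks with the same reading have the same wire set. [folklore] -/
theorem maskSet_eq_of_toReg_eq {m m' : Cfg} (h : toReg N m = toReg N m') : maskSet N m = maskSet N m' := by
  ext i
  rw [mem_maskSet_iff_toReg, mem_maskSet_iff_toReg, h]

/-- **A length-`N` list is determined by its reading.** [folklore] -/
theorem ext_of_toReg_eq {u v : Cfg} (hu : u.length = N) (hv : v.length = N) (h : toReg N u = toReg N v) :
    u = v := by
  apply List.ext_getElem (hu.trans hv.symm)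
  intro i h₁ h₂
  have := congrFun h ⟨i, hu ▸ h₁⟩
  simp only [toReg_apply] at this
  rwa [List.getD_eq_getElem _ _ h₁, List.getD_eq_getElem _ _ h₂] at this

/-- Length-`N` lists are equal iff their readings are. [folklore] -/
theorem eq_iff_toReg_eq {u v : Cfg} (hu : u.length = N) (hv : v.length = N) : u = v ↔ toReg N u = toReg N v :=
  ⟨fun h => h ▸ rfl, ext_of_toReg_eq hu hv⟩

/-- Length-`N` masks are equal iff their wire sets are. [folklore] -/
theorem eq_iff_maskSet_eq {u v : Cfg} (hu : u.length = N) (hv : v.length = N) :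
    u = v ↔ maskSet N u = maskSet N v := by
  refine ⟨fun h => h ▸ rfl, fun h => ext_of_toReg_eq hu hv (funext fun i => ?_)⟩
  have := Finset.ext_iff.1 h i
  rw [mem_maskSet, mem_maskSet] at this
  rw [toReg_apply, toReg_apply]
  rcases hb : u.getD i false with _ | _
  · rcases hb' : v.getD i false with _ | _
    · rfl
    · exact absurd (this.2 hb') (by rw [hb]; decide)
  · exact (this.1 hb).symm

/-! ### Bitwise operations -/

/-- `getD` of a `zipWith` of two lists of equal length, for an operation vanishing on the defaults.
[folklore] -/
theorem getD_zipWith {f : Bool → Bool → Bool} (hf : f false false = false) :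
    ∀ (u v : List Bool), u.length = v.length → ∀ i : ℕ,
      (List.zipWith f u v).getD i false = f (u.getD i false) (v.getD i false)
  | [], [], _, i => by simp [hf]
  | [], _ :: _, h, _ => by simp at h
  | _ :: _, [], h, _ => by simp at h
  | a :: u, b :: v, h, 0 => by simp
  | a :: u, b :: v, h, i + 1 => by
    simp only [List.zipWith_cons_cons, List.getD_cons_succ]
    exact getD_zipWith hf u v (by simpa using h) i

/-- Length of `band`. [folklore] -/
theorem length_band {u v : Cfg} (hu : u.length = N) (hv : v.length = N) : (band u v).length = N := by
  simp [band, List.length_zipWith, hu, hv]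

/-- Length of `bor`. [folklore] -/
theorem length_bor {u v : Cfg} (hu : u.length = N) (hv : v.length = N) : (bor u v).length = N := by
  simp [bor, List.length_zipWith, hu, hv]

/-- Length of `bandnot`. [folklore] -/
theorem length_bandnot {u v : Cfg} (hu : u.length = N) (hv : v.length = N) : (bandnot u v).length = N := by
  simp [bandnot, List.length_zipWith, hu, hv]

/-- Length of `pw`. [folklore] -/
theorem length_pw {S u v : Cfg} (hS : S.length = N) (hu : u.length = N) (hv : v.length = N) :
    (pw S u v).length = N :=
  length_bor (length_band hu hS) (length_bandnot hv hS)

/-- Length of `zeros`. [folklore] -/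
@[simp] theorem length_zeros (N : ℕ) : (zeros N).length = N := by simp [zeros]

/-- Length of `oneHot`. [folklore] -/
@[simp] theorem length_oneHot (N i : ℕ) : (oneHot N i).length = N := by simp [oneHot]

/-- Bits of `band`. [folklore] -/
theorem getD_band {u v : Cfg} (h : u.length = v.length) (i : ℕ) :
    (band u v).getD i false = (u.getD i false && v.getD i false) :=
  getD_zipWith rfl u v h i

/-- Bits of `bor`. [folklore] -/
theorem getD_bor {u v : Cfg} (h : u.length = v.length) (i : ℕ) :
    (bor u v).getD i false = (u.getD i false || v.getD i false) :=
  getD_zipWith rfl u v h i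

/-- Bits of `bandnot`. [folklore] -/
theorem getD_bandnot {u v : Cfg} (h : u.length = v.length) (i : ℕ) :
    (bandnot u v).getD i false = (u.getD i false && !v.getD i false) :=
  getD_zipWith rfl u v h i

/-- Bits of `zeros`. [folklore] -/
@[simp] theorem getD_zeros (N i : ℕ) : (zeros N).getD i false = false := by
  unfold zeros
  rw [List.getD_eq_getElem?_getD, List.getElem?_replicate]
  split_ifs <;> rfl

/-- Bits of `oneHot`. [folklore] -/
theorem getD_oneHot (N i k : ℕ) : (oneHot N i).getD k false = (decide (k < N) && decide (k = i)) := by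
  unfold oneHot
  by_cases h : k < N
  · rw [List.getD_eq_getElem _ _ (by simpa using h)]
    simp [h]
  · rw [List.getD_eq_default _ _ (by simpa using not_lt.1 h)]
    simp [h]

/-- Bits of `pw`: `u` on `S`, `v` off `S`. [folklore] -/
theorem getD_pw {S u v : Cfg} (hS : S.length = N) (hu : u.length = N) (hv : v.length = N) (i : ℕ) :
    (pw S u v).getD i false = if S.getD i false then u.getD i false else v.getD i false := by
  unfold pw
  rw [getD_bor ((length_band hu hS).trans (length_bandnot hv hS).symm), getD_band (hu.trans hS.symm),
    getD_bandnot (hv.trans hS.symm)]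
  cases S.getD i false <;> simp

/-- **`band` reads as the pointwise `∧`.** [folklore] -/
theorem toReg_band {u v : Cfg} (hu : u.length = N) (hv : v.length = N) :
    toReg N (band u v) = fun i => (toReg N u i && toReg N v i) :=
  funext fun i => getD_band (hu.trans hv.symm) i

/-- `bor` reads as the pointwise `∨`. [folklore] -/
theorem toReg_bor {u v : Cfg} (hu : u.length = N) (hv : v.length = N) :
    toReg N (bor u v) = fun i => (toReg N u i || toReg N v i) :=
  funext fun i => getD_bor (hu.trans hv.symm) i

/-- `bandnot` reads as the pointwise `∧ ¬`. [folklore] -/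
theorem toReg_bandnot {u v : Cfg} (hu : u.length = N) (hv : v.length = N) :
    toReg N (bandnot u v) = fun i => (toReg N u i && !toReg N v i) :=
  funext fun i => getD_bandnot (hu.trans hv.symm) i

/-- `zeros N` reads as the zero configuration. [folklore] -/
@[simp] theorem toReg_zeros : toReg N (zeros N) = zeroCfg N :=
  funext fun i => getD_zeros N i

/-- `oneHot N i` reads as the indicator of wire `i`. [folklore] -/
theorem toReg_oneHot (i : ℕ) : toReg N (oneHot N i) = fun k : Fin N => decide ((k : ℕ) = i) :=
  funext fun k => by rw [toReg_apply, getD_oneHot]; simp [k.isLt]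

/-- **Gluing along a mask is `Finset.piecewise` along its wire set**: `pw S u v ↦ S.piecewise u v`.
[folklore] -/
theorem toReg_pw {S u v : Cfg} (hS : S.length = N) (hu : u.length = N) (hv : v.length = N) :
    toReg N (pw S u v) = (maskSet N S).piecewise (toReg N u) (toReg N v) := by
  funext i
  rw [toReg_apply, getD_pw hS hu hv]
  by_cases hi : i ∈ maskSet N S
  · rw [Finset.piecewise_eq_of_mem _ _ _ hi, if_pos (mem_maskSet.1 hi), toReg_apply]
  · rw [Finset.piecewise_eq_of_notMem _ _ _ hi, toReg_apply]
    have : S.getD i false = false := by simpa using hi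
    rw [this]
    rfl

/-- The wire set of `band` is the intersection. [folklore] -/
theorem maskSet_band {u v : Cfg} (hu : u.length = N) (hv : v.length = N) :
    maskSet N (band u v) = maskSet N u ∩ maskSet N v := by
  ext i
  rw [mem_inter, mem_maskSet, mem_maskSet, mem_maskSet, getD_band (hu.trans hv.symm), Bool.and_eq_true]

/-- The wire set of `bor` is the union. [folklore] -/
theorem maskSet_bor {u v : Cfg} (hu : u.length = N) (hv : v.length = N) :
    maskSet N (bor u v) = maskSet N u ∪ maskSet N v := by
  ext i
  rw [mem_union, mem_maskSet, mem_maskSet, mem_maskSet, getD_bor (hu.trans hv.symm), Bool.or_eq_true]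

/-- The wire set of `bandnot` is the difference. [folklore] -/
theorem maskSet_bandnot {u v : Cfg} (hu : u.length = N) (hv : v.length = N) :
    maskSet N (bandnot u v) = maskSet N u \ maskSet N v := by
  ext i
  rw [mem_sdiff, mem_maskSet, mem_maskSet, mem_maskSet, getD_bandnot (hu.trans hv.symm), Bool.and_eq_true,
    Bool.not_eq_true', Bool.eq_false_iff]

/-- The wire set of `zeros` is empty. [folklore] -/
@[simp] theorem maskSet_zeros : maskSet N (zeros N) = ∅ := by
  ext i
  rw [mem_maskSet, getD_zeros]
  simp

/-- The wire set of `oneHot N i` is `{i}` for a wire `i`. [folklore] -/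
theorem maskSet_oneHot (i : Fin N) : maskSet N (oneHot N i) = {i} := by
  ext k
  rw [mem_maskSet, getD_oneHot, mem_singleton]
  simp [k.isLt, Fin.ext_iff]

/-- `bor` with the zero mask on the left is the identity on length-`N` lists. [folklore] -/
theorem bor_zeros_left {u : Cfg} (hu : u.length = N) : bor (zeros N) u = u :=
  ext_of_toReg_eq (length_bor (length_zeros N) hu) hu (by
    rw [toReg_bor (length_zeros N) hu, toReg_zeros]
    funext i
    exact Bool.false_or _)

/-- The wire set of a mask is contained in its index range. [folklore] -/
theorem lt_length_of_mem_maskSet {m : Cfg} {i : Fin N} (h : i ∈ maskSet N m) : (i : ℕ) < m.length := by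
  by_contra hlt
  rw [mem_maskSet, List.getD_eq_default _ _ (not_lt.1 hlt)] at h
  exact Bool.false_ne_true h

/-! ### Positional update -/

/-- `setAt` inside the list is `List.set`. [folklore] -/
theorem setAt_eq_set {u : Cfg} {i : ℕ} (hi : i < u.length) (a : Bool) : setAt u i a = u.set i a := by
  rw [setAt, List.set_eq_take_append_cons_drop, if_pos hi]
  simp

/-- `setAt` inside the list preserves the length. [folklore] -/
theorem length_setAt {u : Cfg} {i : ℕ} (hi : i < u.length) (a : Bool) : (setAt u i a).length = u.length := by
  rw [setAt_eq_set hi, List.length_set]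

/-- Bits of `setAt` inside the list. [folklore] -/
theorem getD_setAt {u : Cfg} {i : ℕ} (hi : i < u.length) (a : Bool) (k : ℕ) :
    (setAt u i a).getD k false = if k = i then a else u.getD k false := by
  rw [setAt_eq_set hi, List.getD_eq_getElem?_getD, List.getElem?_set, List.getD_eq_getElem?_getD]
  by_cases h : k = i
  · subst h
    simp [hi]
  · simp [h, Ne.symm h]

/-- **`setAt` reads as `Function.update`** (for a wire `i` of a length-`N` list). [folklore] -/
theorem toReg_setAt {u : Cfg} (hu : u.length = N) (i : Fin N) (a : Bool) :
    toReg N (setAt u i a) = Function.update (toReg N u) i a := by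
  funext k
  rw [toReg_apply, getD_setAt (hu ▸ i.isLt)]
  by_cases hk : k = i
  · subst hk
    simp
  · rw [Function.update_of_ne hk, if_neg (fun h => hk (Fin.ext h)), toReg_apply]

/-- The padded input: `x ++ zeros m` reads as `padInput x.get m` (`|x⟩|0…0⟩`).
[cite: JozsaLinden2003, §3 (proof of lemma ratpbl: the input |i₁…iₙ⟩|0…0⟩)] -/
theorem toReg_append_zeros (x : List Bool) (m : ℕ) :
    toReg (x.length + m) (x ++ zeros m) = padInput x.get m := by
  funext i
  rw [toReg_apply]
  refine Fin.addCases (fun j => ?_) (fun j => ?_) i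
  · rw [padInput, Fin.append_left, Fin.val_castAdd, List.getD_append _ _ _ _ j.isLt,
      List.getD_eq_getElem _ _ j.isLt]
    rfl
  · rw [padInput, Fin.append_right, Fin.val_natAdd, List.getD_append_right _ _ _ _ (Nat.le_add_right _ _),
      Nat.add_sub_cancel_left, getD_zeros]

/-! ### Bit counts -/

/-- **The bit count of a mask is the size of its wire set** (for a list read on all its positions).
[folklore] -/
theorem popcount_eq_card_maskSet : ∀ (m : Cfg), popcount m = (maskSet m.length m).card
  | [] => by simp [popcount, maskSet]
  | b :: m => by
    have ih := popcount_eq_card_maskSet m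
    have hsplit : maskSet (m.length + 1) (b :: m) =
        (if b = true then {(0 : Fin (m.length + 1))} else ∅) ∪ (maskSet m.length m).map (Fin.succEmb _) := by
      ext i
      refine Fin.cases ?_ (fun j => ?_) i
      · cases b <;> simp [mem_maskSet, Fin.succ_ne_zero]
      · simp only [mem_maskSet, Fin.val_succ, List.getD_cons_succ, mem_union, mem_map,
          Fin.coe_succEmb, Fin.succ_inj, exists_eq_right]
        cases b <;> simp [Fin.succ_ne_zero]
    have hdisj : Disjoint (if b = true then {(0 : Fin (m.length + 1))} else ∅)
        ((maskSet m.length m).map (Fin.succEmb _)) := by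
      cases b
      · simp
      · simp only [ite_true, disjoint_singleton_left, mem_map, Fin.coe_succEmb, not_exists, not_and]
        exact fun j _ => Fin.succ_ne_zero j
    rw [List.length_cons, hsplit, card_union_of_disjoint hdisj, card_map, ← ih, popcount, popcount,
      List.count_cons]
    cases b <;> simp [add_comm]

/-- The bit count of a length-`N` mask is the size of its wire set. [folklore] -/
theorem popcount_eq_card {m : Cfg} (hm : m.length = N) : popcount m = (maskSet N m).card := by
  subst hm
  exact popcount_eq_card_maskSet m

/-! ### The enumeration of the configurations supported in a mask -/

/-- `deposit` preserves the length of the mask. [folklore] -/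
theorem length_deposit : ∀ (k : ℕ) (m : Cfg), (deposit k m).length = m.length
  | _, [] => rfl
  | k, false :: m => by simp [deposit, length_deposit k m]
  | k, true :: m => by simp [deposit, length_deposit (k / 2) m]

/-- `deposit k m` is supported in the mask `m`. [folklore] -/
theorem getD_deposit_imp : ∀ (k : ℕ) (m : Cfg) (i : ℕ), (deposit k m).getD i false = true → m.getD i false = true
  | _, [], i, h => by simp [deposit] at h
  | k, false :: m, 0, h => by simp [deposit] at h
  | k, false :: m, i + 1, h => by
    simp only [deposit, List.getD_cons_succ] at h ⊢
    exact getD_deposit_imp k m i h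
  | k, true :: m, 0, _ => by simp
  | k, true :: m, i + 1, h => by
    simp only [deposit, List.getD_cons_succ] at h ⊢
    exact getD_deposit_imp (k / 2) m i h

/-- `deposit · m` is injective below `2 ^ popcount m`. [folklore] -/
theorem deposit_injOn : ∀ (m : Cfg) (k₁ k₂ : ℕ), k₁ < 2 ^ popcount m → k₂ < 2 ^ popcount m →
    deposit k₁ m = deposit k₂ m → k₁ = k₂
  | [], k₁, k₂, h₁, h₂, _ => by
    simp [popcount] at h₁ h₂
    omega
  | false :: m, k₁, k₂, h₁, h₂, h => by
    have hp : popcount (false :: m) = popcount m := by simp [popcount]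
    rw [hp] at h₁ h₂
    simp only [deposit, List.cons.injEq, true_and] at h
    exact deposit_injOn m k₁ k₂ h₁ h₂ h
  | true :: m, k₁, k₂, h₁, h₂, h => by
    have hp : popcount (true :: m) = popcount m + 1 := by simp [popcount]
    rw [hp, pow_succ] at h₁ h₂
    simp only [deposit, List.cons.injEq, decide_eq_decide] at h
    have ih := deposit_injOn m (k₁ / 2) (k₂ / 2) (by omega) (by omega) h.2
    omega

/-- Every list of the mask's length supported in the mask is a `deposit`. [folklore] -/
theorem exists_deposit_eq : ∀ (m u : Cfg), u.length = m.length →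
    (∀ i : ℕ, u.getD i false = true → m.getD i false = true) → ∃ k < 2 ^ popcount m, deposit k m = u
  | [], [], _, _ => ⟨0, by simp [popcount], rfl⟩
  | [], _ :: _, h, _ => by simp at h
  | _ :: _, [], h, _ => by simp at h
  | false :: m, b :: u, h, hsupp => by
    have hb : b = false := by
      have := hsupp 0
      cases b
      · rfl
      · simp at this
    subst hb
    obtain ⟨k, hk, hku⟩ := exists_deposit_eq m u (by simpa using h) fun i hi => by
      simpa using hsupp (i + 1) (by simpa using hi)
    exact ⟨k, by simpa [popcount] using hk, by simp [deposit, hku]⟩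
  | true :: m, b :: u, h, hsupp => by
    obtain ⟨k, hk, hku⟩ := exists_deposit_eq m u (by simpa using h) fun i hi => by
      simpa using hsupp (i + 1) (by simpa using hi)
    refine ⟨2 * k + (if b then 1 else 0), ?_, ?_⟩
    · have hp : popcount (true :: m) = popcount m + 1 := by simp [popcount]
      rw [hp, pow_succ]
      cases b <;> simp <;> omega
    · simp only [deposit]
      cases b
      · simp only [Bool.false_eq_true, if_false, add_zero, List.cons.injEq]
        refine ⟨by simp [Nat.mul_mod_right], ?_⟩
        rwa [Nat.mul_div_cancel_left k two_pos]
      · simp only [if_true, List.cons.injEq]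
        refine ⟨by simp, ?_⟩
        have : (2 * k + 1) / 2 = k := by omega
        rwa [this]

/-- A length-`N` list supported in the wire set of a length-`N` mask, stated through wire sets. [folklore] -/
theorem supported_iff_maskSet_subset {m u : Cfg} (hu : u.length = N) :
    (∀ i : ℕ, u.getD i false = true → m.getD i false = true) ↔ maskSet N u ⊆ maskSet N m := by
  constructor
  · intro h i hi
    rw [mem_maskSet] at hi ⊢
    exact h i hi
  · intro h i hi
    have hiN : i < N := by
      rw [← hu]
      by_contra hlt
      rw [List.getD_eq_default _ _ (not_lt.1 hlt)] at hi
      exact Bool.false_ne_true hi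
    have := h ((mem_maskSet (i := ⟨i, hiN⟩)).2 hi)
    exact mem_maskSet.1 this

/-- A configuration is supported in `X` iff its reading lies in `cfg X` — for length-`N` lists,
"supported in the mask `m`" is `toReg N u ∈ cfg (maskSet N m)`. [folklore] -/
theorem toReg_mem_cfg_iff {m u : Cfg} : toReg N u ∈ cfg (maskSet N m) ↔ maskSet N u ⊆ maskSet N m := by
  rw [mem_cfg]
  constructor
  · intro h i hi
    by_contra him
    have := h i him
    rw [toReg_apply] at this
    rw [mem_maskSet, this] at hi
    exact Bool.false_ne_true hi
  · intro h i hi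
    rw [toReg_apply]
    by_contra hne
    exact hi (h (mem_maskSet.2 (by simpa using hne)))

/-- Under the cap `popcount m ≤ 2p` the enumeration is complete: `subCfgs p m` lists all
`2 ^ popcount m` deposits. [cite: JozsaLinden2003, §3 (proof of lemma ratpbl, (b): at most 2^{p+1} numbers per block)] -/
theorem subCfgs_eq_of_le {p : ℕ} {m : Cfg} (hp : popcount m ≤ 2 * p) :
    subCfgs p m = (List.range (2 ^ popcount m)).map fun k => deposit k m := by
  unfold subCfgs
  rw [min_eq_left]
  calc 2 ^ popcount m ≤ 2 ^ (2 * p) := Nat.pow_le_pow_right two_pos hp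
    _ = 4 ^ p := by rw [pow_mul]; norm_num

/-- **Membership in the enumeration**: under the cap, `u ∈ subCfgs p m` iff `u` has the length of
`m` and is supported in `m`. [folklore] -/
theorem mem_subCfgs_iff {p : ℕ} {m u : Cfg} (hp : popcount m ≤ 2 * p) :
    u ∈ subCfgs p m ↔ u.length = m.length ∧ ∀ i : ℕ, u.getD i false = true → m.getD i false = true := by
  rw [subCfgs_eq_of_le hp, List.mem_map]
  constructor
  · rintro ⟨k, -, rfl⟩
    exact ⟨length_deposit k m, getD_deposit_imp k m⟩
  · rintro ⟨hlen, hsupp⟩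
    obtain ⟨k, hk, rfl⟩ := exists_deposit_eq m u hlen hsupp
    exact ⟨k, List.mem_range.2 hk, rfl⟩

/-- Membership in the enumeration of a length-`N` mask, through wire sets. [folklore] -/
theorem mem_subCfgs_iff_maskSet {p : ℕ} {m u : Cfg} (hm : m.length = N) (hp : popcount m ≤ 2 * p) :
    u ∈ subCfgs p m ↔ u.length = N ∧ maskSet N u ⊆ maskSet N m := by
  rw [mem_subCfgs_iff hp, hm]
  constructor
  · rintro ⟨hu, h⟩
    exact ⟨hu, (supported_iff_maskSet_subset hu).1 h⟩
  · rintro ⟨hu, h⟩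
    exact ⟨hu, (supported_iff_maskSet_subset hu).2 h⟩

/-- Members of the enumeration have the length of the mask (no cap needed). [folklore] -/
theorem length_of_mem_subCfgs {p : ℕ} {m u : Cfg} (h : u ∈ subCfgs p m) : u.length = m.length := by
  unfold subCfgs at h
  obtain ⟨k, -, rfl⟩ := List.mem_map.1 h
  exact length_deposit k m

/-- Members of the enumeration are supported in the mask (no cap needed). [folklore] -/
theorem maskSet_subset_of_mem_subCfgs {p : ℕ} {m u : Cfg} (hm : m.length = N) (h : u ∈ subCfgs p m) :
    maskSet N u ⊆ maskSet N m := by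
  unfold subCfgs at h
  obtain ⟨k, -, rfl⟩ := List.mem_map.1 h
  exact (supported_iff_maskSet_subset ((length_deposit k m).trans hm)).1 (getD_deposit_imp k m)

/-- **The enumeration has no repetition** (under the cap). [folklore] -/
theorem nodup_subCfgs {p : ℕ} {m : Cfg} (hp : popcount m ≤ 2 * p) : (subCfgs p m).Nodup := by
  rw [subCfgs_eq_of_le hp]
  refine List.Nodup.map_on ?_ (List.nodup_range)
  intro k₁ hk₁ k₂ hk₂ h
  exact deposit_injOn m k₁ k₂ (List.mem_range.1 hk₁) (List.mem_range.1 hk₂) h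

/-- The readings of the enumeration have no repetition (under the cap). [folklore] -/
theorem nodup_map_toReg_subCfgs {p : ℕ} {m : Cfg} (hm : m.length = N) (hp : popcount m ≤ 2 * p) :
    ((subCfgs p m).map (toReg N)).Nodup := by
  refine List.Nodup.map_on (fun u hu v hv h => ?_) (nodup_subCfgs hp)
  exact ext_of_toReg_eq ((length_of_mem_subCfgs hu).trans hm) ((length_of_mem_subCfgs hv).trans hm) h

/-- The reading of a configuration supported in a wire set, as a list: every `r ∈ cfg X` is read off
the length-`N` list `List.ofFn r`. [folklore] -/
theorem toReg_ofFn (r : QReg N) : toReg N (List.ofFn r) = r := by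
  funext i
  rw [toReg_apply, List.getD_eq_getElem _ _ (by simp), List.getElem_ofFn]

/-- **The readings of the enumeration are exactly `cfg (maskSet N m)`** (under the cap). [folklore] -/
theorem mem_map_toReg_subCfgs_iff {p : ℕ} {m : Cfg} (hm : m.length = N) (hp : popcount m ≤ 2 * p)
    (r : QReg N) : r ∈ (subCfgs p m).map (toReg N) ↔ r ∈ cfg (maskSet N m) := by
  rw [List.mem_map]
  constructor
  · rintro ⟨u, hu, rfl⟩
    obtain ⟨hlen, hsub⟩ := (mem_subCfgs_iff_maskSet hm hp).1 hu
    exact toReg_mem_cfg_iff.2 hsub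
  · intro hr
    refine ⟨List.ofFn r, (mem_subCfgs_iff_maskSet hm hp).2 ⟨List.length_ofFn, ?_⟩, toReg_ofFn r⟩
    exact toReg_mem_cfg_iff.1 (by rwa [toReg_ofFn])

/-- The readings of the enumeration, as a finite set, are `cfg (maskSet N m)`. [folklore] -/
theorem toFinset_map_toReg_subCfgs {p : ℕ} {m : Cfg} (hm : m.length = N) (hp : popcount m ≤ 2 * p) :
    ((subCfgs p m).map (toReg N)).toFinset = cfg (maskSet N m) := by
  ext r
  rw [List.mem_toFinset, mem_map_toReg_subCfgs_iff hm hp]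

/-- **List sums over the enumeration are the finite sums over `cfg`** of the quantum half.
[cite: JozsaLinden2003, §3 (proof of lemma ratpbl, (b) and Case 2)] -/
theorem sum_map_subCfgs_eq_sum_cfg {M : Type*} [AddCommMonoid M] {p : ℕ} {m : Cfg} (hm : m.length = N)
    (hp : popcount m ≤ 2 * p) (g : Cfg → M) (g' : QReg N → M) (hg : ∀ u ∈ subCfgs p m, g u = g' (toReg N u)) :
    ((subCfgs p m).map g).sum = ∑ r ∈ cfg (maskSet N m), g' r := by
  rw [← toFinset_map_toReg_subCfgs hm hp, List.sum_toFinset _ (nodup_map_toReg_subCfgs hm hp), List.map_map]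
  congr 1
  exact List.map_congr_left fun u hu => hg u hu

/-- `sumZ` is the list sum. [folklore] -/
theorem sumZ_eq_sum (l : List Literature.Computability.QuantumComplexity.ZW) : sumZ l = l.sum := by
  rw [sumZ, List.sum_eq_foldl]

end PSim

end Literature.Barriers.QuantumAdvantage
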